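import Literature.NumberTheory.Sieve.BombieriFriedlanderIwaniecPiFormLeaves
import Literature.NumberTheory.Sieve.ShiuBrunTitchmarshProofs
import HarnessLib

/-!
# BFI 1986, Theorem 10 and its dyadic form: the DAG with Lemma 3 discharged

Topic `Literature/NumberTheory/Sieve`.  Everything here is PROVED.  A leaf file joining

* `Literature.NumberTheory.Sieve.Theorem10Dyadic_of_leaves` (`…Assembly`): the dyadic form
  `BFI.Theorem10Dyadic` of Bombieri–Friedlander–Iwaniec, Acta Math. 156 (1986), Theorem 10
  (the shape of (15.1), p. 244, for the well-factorable weights of §17, p. 249) from eight named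
  inputs, and its descendants `BombieriFriedlanderIwaniecTheorem10_of_leaves'`,
  `bfi_wellFactorable_level_of_leaves'` (`…Leaves`), `BombieriFriedlanderIwaniecTheorem10Pi_of_leaves`
  (`…PiFormLeaves`), which already feed in the three classical inputs proved in the tree
  (Siegel–Walfisz for `μ`, the fundamental lemma, the prime number theorem), with
* `Literature.NumberTheory.Sieve.BombieriFriedlanderIwaniecLemma3_holds` (`ShiuBrunTitchmarshProofs`):
  BFI §2 Lemma 3 (p. 211), now a THEOREM of the tree (Landreau's inequality in place of Shiu).

Result: the four statements at the top of the DAG —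
`BFI.Theorem10Dyadic`, `BombieriFriedlanderIwaniecTheorem10` (Theorem 10 as printed, p. 209),
`bfi_wellFactorable_level` and `BombieriFriedlanderIwaniecTheorem10Pi` (Maynard's `π`-form) — are
CONDITIONAL exactly on the FIVE remaining unproved named facts of the cone (D-0014):
`BombieriFriedlanderIwaniecTheorem1`, `…Theorem2` (§§3–9, 13: Linnik's dispersion method and the
Deshouillers–Iwaniec bounds for sums of Kloosterman sums), `…Theorem5StarInterval` (§§10–12),
`…Theorem0b` (§2, the Bombieri–Vinogradov theorem for bilinear forms, from the large sieve) and
`Shiu1980BrunTitchmarsh` (Shiu 1980, Theorem 1).  Discharging any of the first three means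
formalising the spectral theory of Kloosterman sums; the last two are provable from the tree
(`largeSieve_bilinear`; sieve and Rankin's method) but are not yet theorems.

## References

* E. Bombieri, J. B. Friedlander, H. Iwaniec, *Primes in arithmetic progressions to large moduli*,
  Acta Math. 156 (1986), 203–251: Theorem 10 p. 209; §2 Lemma 3 p. 211; §15 (15.1) p. 244;
  §17 p. 249. [BombieriFriedlanderIwaniecActa1986]
* J. Maynard, *Primes in arithmetic progressions to large moduli II: Well-factorable estimates*,
  arXiv:2006.07088, p. 3, Theorem (Bombieri, Friedlander, Iwaniec). [Maynard2020LargeModuliII]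
-/

namespace Literature.NumberTheory.Sieve

/-- **The dyadic form of BFI Theorem 10 from the five deep leaves**: `BFI.Theorem10Dyadic` (the
shape of BFI (15.1), p. 244, for the weights of Theorem 10) follows from the source's Theorems 1, 2,
0 (b), 5* (on boxes) and Shiu's theorem (named facts), the other three inputs of
`Theorem10Dyadic_of_leaves` — Lemma 3, the Siegel–Walfisz theorem for `μ` and the fundamental lemma
of the sieve — being theorems of the tree.
[cite: BombieriFriedlanderIwaniecActa1986, §15 (15.1) p. 244; §17 p. 249] -/
theorem BFI.Theorem10Dyadic_of_deep_leaves
    (h1 : BombieriFriedlanderIwaniecTheorem1) (h2 : BombieriFriedlanderIwaniecTheorem2)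
    (h0b : BombieriFriedlanderIwaniecTheorem0b) (h5 : BombieriFriedlanderIwaniecTheorem5StarInterval)
    (hShiu : Shiu1980BrunTitchmarsh) : BFI.Theorem10Dyadic :=
  Theorem10Dyadic_of_leaves h1 h2 h0b h5 BombieriFriedlanderIwaniecLemma3_holds hShiu
    LFunctions.SiegelWalfiszMoebius_holds SieveSequence.fundamental_lemma_uniform_holds

/-- **BFI Theorem 10 as printed (p. 209) from the five deep leaves** (Theorems 1, 2, 0 (b), 5* on
boxes; Shiu 1980), through the dyadic form and the reduction
`BombieriFriedlanderIwaniecTheorem10_of_dyadic'` (prime number theorem supplied by the tree).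
[cite: BombieriFriedlanderIwaniecActa1986, Theorem 10 p. 209] -/
theorem BombieriFriedlanderIwaniecTheorem10_of_deep_leaves
    (h1 : BombieriFriedlanderIwaniecTheorem1) (h2 : BombieriFriedlanderIwaniecTheorem2)
    (h0b : BombieriFriedlanderIwaniecTheorem0b) (h5 : BombieriFriedlanderIwaniecTheorem5StarInterval)
    (hShiu : Shiu1980BrunTitchmarsh) : BombieriFriedlanderIwaniecTheorem10 :=
  BombieriFriedlanderIwaniecTheorem10_of_dyadic' (BFI.Theorem10Dyadic_of_deep_leaves h1 h2 h0b h5 hShiu)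

/-- **The tree's fact `bfi_wellFactorable_level` from the five deep leaves.**
[cite: BombieriFriedlanderIwaniecActa1986, Theorem 10 p. 209] -/
theorem bfi_wellFactorable_level_of_deep_leaves
    (h1 : BombieriFriedlanderIwaniecTheorem1) (h2 : BombieriFriedlanderIwaniecTheorem2)
    (h0b : BombieriFriedlanderIwaniecTheorem0b) (h5 : BombieriFriedlanderIwaniecTheorem5StarInterval)
    (hShiu : Shiu1980BrunTitchmarsh) : bfi_wellFactorable_level :=
  bfi_wellFactorable_level_of_theorem10
    (BombieriFriedlanderIwaniecTheorem10_of_deep_leaves h1 h2 h0b h5 hShiu)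

/-- **BFI Theorem 10, `π`-form (Maynard, arXiv:2006.07088, p. 3) from the five deep leaves.**
[cite: Maynard2020LargeModuliII, p. 3, Theorem (Bombieri–Friedlander–Iwaniec)] -/
theorem BombieriFriedlanderIwaniecTheorem10Pi_of_deep_leaves
    (h1 : BombieriFriedlanderIwaniecTheorem1) (h2 : BombieriFriedlanderIwaniecTheorem2)
    (h0b : BombieriFriedlanderIwaniecTheorem0b) (h5 : BombieriFriedlanderIwaniecTheorem5StarInterval)
    (hShiu : Shiu1980BrunTitchmarsh) : BombieriFriedlanderIwaniecTheorem10Pi :=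
  BombieriFriedlanderIwaniecTheorem10Pi_of_theorem10
    (BombieriFriedlanderIwaniecTheorem10_of_deep_leaves h1 h2 h0b h5 hShiu)

end Literature.NumberTheory.Sieve
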